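import Mathlib
import HarnessLib

/-!
# Route `ThetaPartnerAtTwo` (TP2), crux K3 `SignedKatoDivisibilityUpToAtTwo` (stmt-BirchSwinnertonDyer-20308 / K3P′ 25631), line
# `colemanrat` v12 — the CUSP-FACTOR SPAN LEMMA (finite-group algebra behind «μ ∉ 𝔭» at the EXCEPTIONAL height-one primes)

Width seat `bsd-wall-tp2-p2x-w2` g6 (cell `bsd-wall`). HONEST FRAMING: theorems only (no definition, no named fact, no instance, no
`sorry`); pure linear algebra over a finite abelian group; closes no item; K3 / K3P′ are NOT settled and BSD is NOT proved by any of this.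

## Why (memo `Cruxes/SignedKatoDivisibilityUpToAtTwo/W2G6-KATO1312-AT2.md` §2)

In the K3 assembly (lead memo G6-LEAD-v11 v4.1) the explicit reciprocity law at `2` is read character by character and the socket
CORE_χ (`SignedKatoOffTwo.CoreChi.core_fin_of_coreChi`) needs an element `μ ∈ Λ ∖ 𝔭`; the `μ` produced by Kato's `(c,d)`-zeta elements of
cusp type `a(2^e)` is (up to harmless factors) the RATIONAL four-term cusp factor
`μ̃(c,d) = c²d²·s(1) − cd²·s(c)·U_c − c²d·s(d⁻¹)·U_d + cd·s(cd⁻¹)·U_cU_d`, `s(b) = [ab/2^e]⁻_f` (tree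
`Kato2004.EulerSystemValues.cuspFactor f true …`; even characters see the cusps through MINUS symbols), `U_c ∈ Λ` the avatar of `σ_c`.
Choosing `(c,d)` with `μ̃ ∉ 𝔭` is Kato's Thm 12.6 / §13.12 (Astérisque 295, pp. 229–233), done there with an auxiliary character of
`2`-power conductor whose values are NOT in `ℤ₂`; over the tree's `Λ = ℤ₂⟦T⟧` one argues instead: at an EXCEPTIONAL prime
(`𝔭 ∋ (1+T)^{2^{e−2}} − 5^{2^{e−2}}`) the reduction of `U_c` is `c·θ(c̄)` for a character `θ` of `G_e = (ℤ/2^e)^×` with values in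
`L = Frac(Λ/𝔭)`, and `μ̃ mod 𝔭 = c²d²·B_θ(c̄,d̄)` with the bracket
`B_{θ₁,θ₂}(c,d) = s(1) − θ₁(c)s(c) − θ₂(d)s(d⁻¹) + θ₁(c)θ₂(d)s(cd⁻¹)`.
THIS FILE: if `B_{θ₁,θ₂} ≡ 0` on `G × G` then `s ∈ span_L(θ̄₁, θ₂)` (§1, a functional equation), hence the ℚ-span `V` of the
translates `x ↦ s(gx)` has `dim_ℚ V ≤ 2` (§2); while three distinct characters `ψ_i : G → E` (any field of characteristic `0`, e.g. `ℂ`)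
with `∑_x ψ_i(x)s(x) ≠ 0` force `dim_ℚ V ≥ 3` (§3, isotypic projections + Dedekind independence); so such `ψ_i` give `(c,d)` with
`B_{θ₁,θ₂}(c,d) ≠ 0` for EVERY pair of characters `θ₁, θ₂` over EVERY field of characteristic `0` (§4). The supply of the three `ψ_i`
(Rohrlich + odd Birch) and the `Λ`-side reduction are the sequel files `…CuspFactorOddTwistSupply`, `…CuspFactorGeneration`.

References: [Kato2004Asterisque] K. Kato, Astérisque 295 (2004), Thm. 12.6 (p. 222), §13.9–13.12 (pp. 229–233), Lemma 13.11 (p. 231),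
Thm. 13.5 (2) (p. 227); the independence of characters used in §3 is Dedekind's lemma (Mathlib `linearIndependent_monoidHom`;
S. Lang, *Algebra*, VI §4 Thm. 4.1).
-/

set_option autoImplicit false
-- the Theorems namespace of this sub repeats the summit name by design (D-0017 nested layout)
set_option linter.dupNamespace false

noncomputable section

open scoped BigOperators

namespace Summit.BirchSwinnertonDyer.BirchSwinnertonDyer.Theorems.SignedKatoOffTwo.CuspSpan

variable {G : Type*} [CommGroup G] [Fintype G]

/-! ## §1 The functional equation: `B_{θ₁,θ₂} ≡ 0` forces `s ∈ span_L(θ̄₁, θ₂)` -/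

/-- **`B ≡ 0 ⟹ s = α·θ̄₁ + β·θ₂`.** Let `G` be a finite abelian group, `L` a field of characteristic `0`, `θ₁ θ₂ : G →* L` characters
and `s : G → ℚ`. If the cusp bracket `s(1) − θ₁(c)s(c) − θ₂(d)s(d⁻¹) + θ₁(c)θ₂(d)s(cd⁻¹)` vanishes for all `c, d ∈ G`, then
`s(x) = α·θ₁(x⁻¹) + β·θ₂(x)` for some `α, β ∈ L`. Proof: with `w = θ₁·s`, `φ = θ₁θ₂` the hypothesis reads
`w(cy) − w(y) = φ(y)(w(c) − w(1))`; symmetrising, `W = w − w(1)` satisfies `W(y)(1 − φ(c)) = W(c)(1 − φ(y))`, so `W = λ(1 − φ)` if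
`φ ≠ 1`, and `W` is additive — hence `0` on the finite group `G` — if `φ = 1`. (The algebra behind Kato's use of Lemma 13.11 in §13.12,
run without the auxiliary character.) [cite: Kato2004Asterisque, §13.12 (pp. 231–233)] -/
theorem exists_coeff_of_forall_bracket_eq_zero {L : Type*} [Field L] [CharZero L] (θ₁ θ₂ : G →* L) (s : G → ℚ)
    (hB : ∀ c d : G, (s 1 : L) - θ₁ c * s c - θ₂ d * s d⁻¹ + θ₁ c * θ₂ d * s (c * d⁻¹) = 0) :
    ∃ α β : L, ∀ x : G, (s x : L) = α * θ₁ x⁻¹ + β * θ₂ x := by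
  -- units: characters of a group into a field take invertible values
  have hθ₁ : ∀ x : G, θ₁ x ≠ 0 := fun x h ↦ by
    have := congrArg (· * θ₁ x⁻¹) h
    simp only [zero_mul, ← map_mul, mul_inv_cancel, map_one] at this
    exact one_ne_zero this
  have hθ₂ : ∀ x : G, θ₂ x ≠ 0 := fun x h ↦ by
    have := congrArg (· * θ₂ x⁻¹) h
    simp only [zero_mul, ← map_mul, mul_inv_cancel, map_one] at this
    exact one_ne_zero this
  have hinv₁ : ∀ x : G, θ₁ x⁻¹ = (θ₁ x)⁻¹ := fun x ↦ map_inv θ₁ x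
  have hinv₂ : ∀ x : G, θ₂ x⁻¹ = (θ₂ x)⁻¹ := fun x ↦ map_inv θ₂ x
  -- `w = θ₁ · s`, `W = w − w 1`, `φ = θ₁ θ₂`
  set w : G → L := fun x ↦ θ₁ x * s x with hw
  have hw1 : w 1 = s 1 := by simp [hw]
  have key : ∀ c y : G, w (c * y) - w y = θ₁ y * θ₂ y * (w c - w 1) := by
    intro c y
    have h := hB c y⁻¹
    rw [inv_inv, hinv₂] at h
    have hu : θ₂ y * (θ₂ y)⁻¹ = 1 := mul_inv_cancel₀ (hθ₂ y)
    simp only [hw, map_mul, map_one, one_mul]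
    linear_combination (θ₁ y * θ₂ y) * h - (θ₁ c * θ₁ y * (s (c * y) : L) - θ₁ y * (s y : L)) * hu
  have hW : ∀ c y : G, (w y - w 1) * (1 - θ₁ c * θ₂ c) = (w c - w 1) * (1 - θ₁ y * θ₂ y) := by
    intro c y
    have h1 := key c y
    have h2 := key y c
    rw [mul_comm y c] at h2
    linear_combination h2 - h1
  by_cases hφ : ∃ y₀ : G, θ₁ y₀ * θ₂ y₀ ≠ 1
  · obtain ⟨y₀, hy₀⟩ := hφ
    have hne : (1 : L) - θ₁ y₀ * θ₂ y₀ ≠ 0 := sub_ne_zero.mpr (Ne.symm hy₀)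
    set lam : L := (w y₀ - w 1) / (1 - θ₁ y₀ * θ₂ y₀) with hlam
    have hWc : ∀ c : G, w c - w 1 = lam * (1 - θ₁ c * θ₂ c) := by
      intro c
      rw [hlam, div_mul_eq_mul_div, eq_div_iff hne]
      exact (hW c y₀).symm
    refine ⟨w 1 + lam, -lam, fun x ↦ ?_⟩
    have hx := hWc x
    rw [hinv₁]
    have hsx : (s x : L) = (θ₁ x)⁻¹ * w x := by
      simp only [hw]; rw [← mul_assoc, inv_mul_cancel₀ (hθ₁ x), one_mul]
    have hu : θ₁ x * (θ₁ x)⁻¹ = 1 := mul_inv_cancel₀ (hθ₁ x)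
    rw [hsx, show w x = w 1 + lam * (1 - θ₁ x * θ₂ x) by linear_combination hx]
    linear_combination (-(lam * θ₂ x)) * hu
  · push Not at hφ
    -- `φ = 1`: `W` is additive on the finite group `G`, hence zero
    have hadd : ∀ c y : G, w (c * y) - w 1 = (w c - w 1) + (w y - w 1) := by
      intro c y
      have h := key c y
      rw [hφ y, one_mul] at h
      linear_combination h
    have hpow : ∀ (x : G) (n : ℕ), w (x ^ n) - w 1 = n * (w x - w 1) := by
      intro x n
      induction n with
      | zero => simp
      | succ n ih => rw [pow_succ, hadd, ih]; push_cast; ring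
    have hWzero : ∀ x : G, w x - w 1 = 0 := by
      intro x
      have h := hpow x (Fintype.card G)
      rw [pow_card_eq_one, sub_self] at h
      have hcard : ((Fintype.card G : ℕ) : L) ≠ 0 := Nat.cast_ne_zero.mpr Fintype.card_ne_zero
      exact (mul_eq_zero.mp h.symm).resolve_left hcard
    refine ⟨w 1, 0, fun x ↦ ?_⟩
    rw [zero_mul, add_zero, hinv₁]
    have hsx : (s x : L) = (θ₁ x)⁻¹ * w x := by
      simp only [hw]; rw [← mul_assoc, inv_mul_cancel₀ (hθ₁ x), one_mul]
    rw [hsx, show w x = w 1 from sub_eq_zero.mp (hWzero x), mul_comm]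

/-! ## §2 Consequence: the ℚ-span of the translates of `s` has dimension `≤ 2` -/

/-- **`B_{θ₁,θ₂} ≡ 0 ⟹ dim_ℚ ⟨x ↦ s(gx) : g ∈ G⟩ ≤ 2`.** Every translate of `s` — indeed every element `v` of their ℚ-span `V` —
is again of the form `α·θ̄₁ + β·θ₂` over `L` (§1), and such a RATIONAL function is determined by its values at `1` and at one point
`x₀` separating `θ̄₁` from `θ₂` (if any; if none, by its value at `1` alone); so `v ↦ (v(1), v(x₀))` embeds `V` into `ℚ²`. No base
change is used. [cite: Kato2004Asterisque, §13.12 (pp. 231–233)] -/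
theorem finrank_span_translates_le_two {L : Type*} [Field L] [CharZero L] (θ₁ θ₂ : G →* L) (s : G → ℚ)
    (hB : ∀ c d : G, (s 1 : L) - θ₁ c * s c - θ₂ d * s d⁻¹ + θ₁ c * θ₂ d * s (c * d⁻¹) = 0) :
    Module.finrank ℚ (Submodule.span ℚ (Set.range fun g : G ↦ (fun x : G ↦ s (g * x)))) ≤ 2 := by
  classical
  obtain ⟨α, β, hs⟩ := exists_coeff_of_forall_bracket_eq_zero θ₁ θ₂ s hB
  -- the ℚ-subspace of rational functions that are `L`-combinations of `θ̄₁, θ₂`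
  let S : Submodule ℚ (G → ℚ) :=
    { carrier := {v | ∃ a b : L, ∀ x : G, (v x : L) = a * θ₁ x⁻¹ + b * θ₂ x}
      add_mem' := by
        rintro v v' ⟨a, b, hv⟩ ⟨a', b', hv'⟩
        refine ⟨a + a', b + b', fun x ↦ ?_⟩
        simp only [Pi.add_apply, Rat.cast_add, hv x, hv' x]; ring
      zero_mem' := ⟨0, 0, fun x ↦ by simp⟩
      smul_mem' := by
        rintro q v ⟨a, b, hv⟩
        refine ⟨q * a, q * b, fun x ↦ ?_⟩
        simp only [Pi.smul_apply, smul_eq_mul, Rat.cast_mul, hv x]; ring }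
  have hVS : Submodule.span ℚ (Set.range fun g : G ↦ (fun x : G ↦ s (g * x))) ≤ S := by
    refine Submodule.span_le.mpr ?_
    rintro _ ⟨g, rfl⟩
    refine ⟨α * θ₁ g⁻¹, β * θ₂ g, fun x ↦ ?_⟩
    simp only [hs (g * x), mul_inv, map_mul]; ring
  -- a point separating `θ̄₁` from `θ₂`, if there is one
  let x₀ : G := if h : ∃ x : G, θ₁ x⁻¹ ≠ θ₂ x then h.choose else 1
  have hinj : ∀ v ∈ S, v 1 = 0 → v x₀ = 0 → v = 0 := by
    rintro v ⟨a, b, hv⟩ h1 h0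
    have hab : a + b = 0 := by
      have := hv 1
      rw [h1, Rat.cast_zero, inv_one, map_one, map_one, mul_one, mul_one] at this
      exact this.symm
    have hb : b = -a := by linear_combination hab
    have hvx : ∀ x : G, (v x : L) = a * (θ₁ x⁻¹ - θ₂ x) := fun x ↦ by rw [hv x, hb]; ring
    have ha : ∀ x : G, a * (θ₁ x⁻¹ - θ₂ x) = 0 := by
      by_cases h : ∃ x : G, θ₁ x⁻¹ ≠ θ₂ x
      · have hx₀ : θ₁ x₀⁻¹ ≠ θ₂ x₀ := by
          simp only [x₀, dif_pos h]
          exact h.choose_spec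
        have h0' : a * (θ₁ x₀⁻¹ - θ₂ x₀) = 0 := by rw [← hvx x₀, h0, Rat.cast_zero]
        have ha0 : a = 0 := (mul_eq_zero.mp h0').resolve_right (sub_ne_zero.mpr hx₀)
        intro x; rw [ha0, zero_mul]
      · push Not at h
        intro x; rw [h x, sub_self, mul_zero]
    funext x
    have : (v x : L) = 0 := by rw [hvx x, ha x]
    exact_mod_cast this
  -- the evaluation map `v ↦ (v 1, v x₀)` restricted to the span is injective
  let ev : (G → ℚ) →ₗ[ℚ] ℚ × ℚ := (LinearMap.proj 1).prod (LinearMap.proj x₀)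
  let f := ev.comp (Submodule.span ℚ (Set.range fun g : G ↦ (fun x : G ↦ s (g * x)))).subtype
  have hf : Function.Injective f := by
    rw [injective_iff_map_eq_zero]
    intro v hv
    have hv0 : ev (v : G → ℚ) = 0 := hv
    have h1 : (v : G → ℚ) 1 = 0 := congrArg Prod.fst hv0
    have h2 : (v : G → ℚ) x₀ = 0 := congrArg Prod.snd hv0
    exact Subtype.ext (hinj _ (hVS v.2) h1 h2)
  calc Module.finrank ℚ (Submodule.span ℚ (Set.range fun g : G ↦ (fun x : G ↦ s (g * x))))
      ≤ Module.finrank ℚ (ℚ × ℚ) := LinearMap.finrank_le_finrank_of_injective hf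
    _ = 2 := by simp

/-! ## §3 Three characters with non-vanishing twisted sums force dimension `≥ 3` -/

/-- **Isotypic projection.** For a character `ψ : G → E` and `s : G → ℚ`:
`∑_g ψ(g)·s(gx) = (∑_y ψ(y)s(y))·ψ(x⁻¹)` (re-index `y = gx`). [folklore] -/
theorem sum_mul_translate_eq {E : Type*} [Field E] (ψ : G →* E) (s : G → ℚ) (x : G) :
    ∑ g : G, ψ g * (s (g * x) : E) = (∑ y : G, ψ y * (s y : E)) * ψ x⁻¹ := by
  rw [Finset.sum_mul]
  refine Fintype.sum_equiv (Equiv.mulRight x) _ _ fun g ↦ ?_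
  simp only [Equiv.coe_mulRight, map_mul]
  have : ψ x * ψ x⁻¹ = 1 := by rw [← map_mul, mul_inv_cancel, map_one]
  linear_combination (-(ψ g * (s (g * x) : E))) * this

/-- **Three distinct characters `ψ₁, ψ₂, ψ₃ : G → E` (any field of characteristic `0`, e.g. `ℂ`) with `∑_x ψ_i(x)s(x) ≠ 0` force
`dim_ℚ ⟨x ↦ s(gx) : g ∈ G⟩ ≥ 3`.** The `E`-span of the (casts of the) translates is spanned by the casts of a ℚ-basis of `V`, so has
`E`-dimension `≤ dim_ℚ V`; it contains the isotypic projections `∑_g ψ_i(g)·s(g·) = ŝ(ψ_i)·ψ̄_i` (`sum_mul_translate_eq`), three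
non-zero multiples of DISTINCT characters, which are linearly independent (Dedekind; Mathlib `linearIndependent_monoidHom`).
[cite: Kato2004Asterisque, Lemma 13.11 (2) (p. 231)] -/
theorem three_le_finrank_span_translates {E : Type*} [Field E] [CharZero E] (s : G → ℚ) (ψ : Fin 3 → (G →* E))
    (hψ : Function.Injective ψ) (hne : ∀ i, ∑ x : G, ψ i x * (s x : E) ≠ 0) :
    3 ≤ Module.finrank ℚ (Submodule.span ℚ (Set.range fun g : G ↦ (fun x : G ↦ s (g * x)))) := by
  classical
  set V := Submodule.span ℚ (Set.range fun g : G ↦ (fun x : G ↦ s (g * x))) with hV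
  let b := Module.finBasis ℚ V
  -- the casts of a ℚ-basis of `V`, and their `E`-span
  let Bv : Fin (Module.finrank ℚ V) → (G → E) := fun j x ↦ (((b j : V) : G → ℚ) x : E)
  let VE : Submodule E (G → E) := Submodule.span E (Set.range Bv)
  have hVE : Module.finrank E VE ≤ Module.finrank ℚ V := by
    have h := finrank_range_le_card (R := E) Bv
    rw [Fintype.card_fin] at h
    exact h
  -- every cast translate lies in `VE`
  have hT : ∀ g : G, (fun x : G ↦ (s (g * x) : E)) ∈ VE := by
    intro g
    have hmem : (fun x : G ↦ s (g * x)) ∈ V := Submodule.subset_span ⟨g, rfl⟩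
    have hrepr := b.sum_repr ⟨_, hmem⟩
    -- coordinates
    have hcoord : ∀ x : G, s (g * x) = ∑ j, b.repr ⟨_, hmem⟩ j * ((b j : V) : G → ℚ) x := by
      intro x
      have := congrArg (fun v : V ↦ (v : G → ℚ) x) hrepr
      simp only [Submodule.coe_sum, Submodule.coe_smul, Finset.sum_apply, Pi.smul_apply, smul_eq_mul] at this
      exact this.symm
    have hfun : (fun x : G ↦ (s (g * x) : E)) = ∑ j, ((b.repr ⟨_, hmem⟩ j : ℚ) : E) • Bv j := by
      funext x
      simp only [hcoord x, Rat.cast_sum, Rat.cast_mul, Finset.sum_apply, Pi.smul_apply, smul_eq_mul, Bv]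
    rw [hfun]
    exact Submodule.sum_mem _ fun j _ ↦ Submodule.smul_mem _ _ (Submodule.subset_span ⟨j, rfl⟩)
  -- the three isotypic vectors
  let wv : Fin 3 → (G → E) := fun i x ↦ ∑ g : G, ψ i g * (s (g * x) : E)
  have hw_mem : ∀ i, wv i ∈ VE := by
    intro i
    have hfun : wv i = ∑ g : G, ψ i g • (fun x : G ↦ (s (g * x) : E)) := by
      funext x; simp only [wv, Finset.sum_apply, Pi.smul_apply, smul_eq_mul]
    rw [hfun]
    exact Submodule.sum_mem _ fun g _ ↦ Submodule.smul_mem _ _ (hT g)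
  -- they are non-zero multiples of the distinct characters `ψ̄_i`
  let χ : Fin 3 → (G →* E) := fun i ↦ (ψ i).comp (invMonoidHom : G →* G)
  have hχ : ∀ i x, χ i x = ψ i x⁻¹ := fun i x ↦ rfl
  have hχinj : Function.Injective χ := by
    intro i j hij
    apply hψ
    ext x
    have := DFunLike.congr_fun hij x⁻¹
    simpa [hχ] using this
  have hli₀ : LinearIndependent E fun i ↦ ((χ i : G →* E) : G → E) :=
    (linearIndependent_monoidHom G E).comp χ hχinj
  have hw_eq : wv = fun i ↦ (Units.mk0 _ (hne i) : Eˣ) • ((χ i : G →* E) : G → E) := by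
    funext i x
    simp only [wv, Pi.smul_apply, Units.smul_mk0, smul_eq_mul, hχ]
    rw [sum_mul_translate_eq]
  have hli : LinearIndependent E wv := by
    rw [hw_eq]
    exact hli₀.units_smul _
  have h3 : Module.finrank E (Submodule.span E (Set.range wv)) = 3 := by
    rw [finrank_span_eq_card hli, Fintype.card_fin]
  have hle : Submodule.span E (Set.range wv) ≤ VE := Submodule.span_le.mpr (by rintro _ ⟨i, rfl⟩; exact hw_mem i)
  have := Submodule.finrank_mono hle
  omega

/-! ## §4 The punch line: some `(c, d)` has non-zero cusp bracket -/

/-- **Some `(c,d)` has `B_{θ₁,θ₂}(c,d) ≠ 0`.** For a finite abelian group `G`, `s : G → ℚ`, ANY two characters `θ₁, θ₂` of `G` with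
values in ANY field `L` of characteristic `0` (in the application: `L = Frac(Λ/𝔭)` at an exceptional height-one prime `𝔭` of
`Λ = ℤ₂⟦T⟧`, `θ₁ = θ₂^{±1}` the character through which `σ_c ↦ c·θ(c̄)` reduces): if three distinct characters `ψ_i : G → E` over
some field `E` of characteristic `0` (in the application: `E = ℂ`, `ψ_i` odd of conductor `2^e` with `L(f, ψ̄_i, 1) ≠ 0` — Rohrlich +
odd Birch) have `∑_x ψ_i(x)s(x) ≠ 0`, then `s(1) − θ₁(c)s(c) − θ₂(d)s(d⁻¹) + θ₁(c)θ₂(d)s(cd⁻¹) ≠ 0` for some `c, d ∈ G`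
(§2: `≡ 0` would give `dim_ℚ ≤ 2`; §3: the `ψ_i` give `dim_ℚ ≥ 3`). This is the `ℤ₂⟦T⟧`-coefficient replacement for Kato's choice
of an auxiliary character in §13.12. [cite: Kato2004Asterisque, Thm. 12.6 (p. 222), §13.12 (pp. 231–233)] -/
theorem exists_bracket_ne_zero {L : Type*} [Field L] [CharZero L] {E : Type*} [Field E] [CharZero E]
    (θ₁ θ₂ : G →* L) (s : G → ℚ) (ψ : Fin 3 → (G →* E)) (hψ : Function.Injective ψ)
    (hne : ∀ i, ∑ x : G, ψ i x * (s x : E) ≠ 0) :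
    ∃ c d : G, (s 1 : L) - θ₁ c * s c - θ₂ d * s d⁻¹ + θ₁ c * θ₂ d * s (c * d⁻¹) ≠ 0 := by
  by_contra h
  push Not at h
  have h2 := finrank_span_translates_le_two θ₁ θ₂ s h
  have h3 := three_le_finrank_span_translates s ψ hψ hne
  omega

/-- **Scaled form** (the shape in which the cusp factor appears: `c²d²·s(1) − cd²·s(c)·u_c − c²d·s(d⁻¹)·u_d + cd·s(cd⁻¹)·u_cu_d`
with `u_c = κ(c)·θ₁(c)`, `u_d = κ(d)·θ₂(d)` for a "weight" `κ : G → L` with non-zero values — in the application `κ(c̄) = c`, the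
odd integer itself, read in `Λ/𝔭`): some `(c, d)` makes it non-zero. [cite: Kato2004Asterisque, §13.12 (pp. 231–233)] -/
theorem exists_scaled_bracket_ne_zero {L : Type*} [Field L] [CharZero L] {E : Type*} [Field E] [CharZero E]
    (θ₁ θ₂ : G →* L) (κ : G → L) (hκ : ∀ x, κ x ≠ 0) (s : G → ℚ) (ψ : Fin 3 → (G →* E))
    (hψ : Function.Injective ψ) (hne : ∀ i, ∑ x : G, ψ i x * (s x : E) ≠ 0) :
    ∃ c d : G, κ c ^ 2 * κ d ^ 2 * (s 1 : L) - κ c * κ d ^ 2 * s c * (κ c * θ₁ c)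
      - κ c ^ 2 * κ d * s d⁻¹ * (κ d * θ₂ d) + κ c * κ d * s (c * d⁻¹) * ((κ c * θ₁ c) * (κ d * θ₂ d)) ≠ 0 := by
  obtain ⟨c, d, h⟩ := exists_bracket_ne_zero θ₁ θ₂ s ψ hψ hne
  refine ⟨c, d, fun h0 ↦ h ?_⟩
  have hcd : κ c ^ 2 * κ d ^ 2 ≠ 0 := mul_ne_zero (pow_ne_zero _ (hκ c)) (pow_ne_zero _ (hκ d))
  have : κ c ^ 2 * κ d ^ 2 *
      ((s 1 : L) - θ₁ c * s c - θ₂ d * s d⁻¹ + θ₁ c * θ₂ d * s (c * d⁻¹)) = 0 := by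
    linear_combination h0
  exact (mul_eq_zero.mp this).resolve_left hcd

end Summit.BirchSwinnertonDyer.BirchSwinnertonDyer.Theorems.SignedKatoOffTwo.CuspSpan

end
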